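import Summits.AtomisticToContinuum.HydrodynamicLimit.Theorems.CollisionIsometryCLTAdaptedWeightCLTContactBalance

/-!
# Vocabulary of the line `sustained-anisotropy-superexp` for the crux `AdaptedWeightCLT`
(stmt-AtomisticToContinuum-14868, rev-12 TIME-LOCAL form; route `CollisionIsometryCLT`, sub-problem
`HydrodynamicLimit`)

Definitions-only support file (`--supports stmt-AtomisticToContinuum-14868`) of the line lead
`prover-line-stmt-AtomisticToContinuum-14868-a1-0` (skeleton `Cruxes/AdaptedWeightCLT/Lines/sustained_anisotropy_superexp.lean`,
card `Cruxes/AdaptedWeightCLT/Lines/sustained-anisotropy-superexp.md`, idea `Cruxes/AdaptedWeightCLT/Ideas/sustained-anisotropy-superexp.md`,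
crux-plan seat `planner-cruxplan-stmt-AtomisticToContinuum-14868-sustained-anisotropy-0`). It makes the line's vocabulary
IMPORTABLE so that each registered stub (`stub_scaleSplit`, `stub_reynolds`, `stub_superExp`, `stub_window`) lands in its own
sorry-free Theorems file with the registered signature verbatim (the bodies below are byte-for-byte those of the registered
skeleton; only the namespace changes). Nothing is asserted here: every `def … : Prop` is a predicate taken as a HYPOTHESIS by
the composition `AdaptedWeightCLT_of` of the skeleton and PROVED by the stub of the same name.

THE LINE. The crux functional `X = ∫₀ᵗ∫ₓ Σ D² + |q|²` (`DefectSq`) is split BY SCALE with an auxiliary sub-block CELL kernel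
`ψ_N` of radius `ℓ_N` (`CellKernel`): subtracting from every particle the cell velocity at its own position (`cvel`) gives
`defectC ≤ 2·cellA + K·ethC·reyC` pointwise (`ScaleSplitStub`); the Reynolds factor `reyC` is the declared exposure
(`ReynoldsStub`); the cell part is priced at equilibrium on kinetic windows (`Window`, `winA`, `winTail`, `susEvent`,
`SuperExpStub`) and integrated up to the horizon with H1/H2 (`WindowStub`, `CellInt`, `ReynInt`).

Objects: `CellKernel`, `Window`, `cvel`, `pecA`, `cellA`, `ethC`, `reyC`, `CellInt`, `ReynInt`, `winA`, `winTail`, `susEvent`;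
statements `ScaleSplitStub`, `ReynoldsStub`, `SuperExpStub`, `WindowStub`.
-/

namespace Summit.AtomisticToContinuum.HydrodynamicLimit.Theorems.SustainedAnisotropy

open scoped BigOperators Topology Classical MeasureTheory ENNReal InnerProductSpace
open Filter Set MeasureTheory
open Literature.Analysis.FluidPDE
open Summit.AtomisticToContinuum.HydrodynamicLimit.Theorems.ContactSourceDuhamel
open Summit.AtomisticToContinuum.HydrodynamicLimit.Theorems.ContactSourceDuhamel.TimeLocal
open Summit.AtomisticToContinuum.HydrodynamicLimit.Theorems.ContactBalance
open Literature.MathematicalPhysics.KineticTheory (hsDiameter localGibbsLaw empiricalDensityField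
  empiricalMomentumField)

noncomputable section

/-! ## Vocabulary: cell kernels, kinetic windows, the scale split of the block defect -/

/-- CELL KERNEL FAMILIES `ψ_N` of radius `ℓ_N`: continuous, nonnegative, mass one, supported in the ball of radius `ℓ_N`,
height `≤ Cψ ℓ_N⁻³`, bounded below by `cψ ℓ_N⁻³` on the ball of radius `ℓ_N/2` (so that cell means are honest averages
over `≍ m_cell` particles), SUB-BLOCK for every admissible block exponent (`ℓ_N (N+1)^{1/6} → 0`, block radius
`(N+1)^{−γ} ≥ (N+1)^{−1/15}`) and containing many particles (`m_cell = (N+1) ℓ_N³ → ∞`, thermal noise of a cell mean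
`≍ m_cell^{−1/2} → 0`). No smoothness is needed anywhere in the line. -/
def CellKernel (ψ : ℕ → T3 → ℝ) (ℓ : ℕ → ℝ) : Prop :=
  (∀ N, Continuous (ψ N)) ∧ (∀ N y, 0 ≤ ψ N y) ∧ (∀ N, ∫ y, ψ N y = 1) ∧ (∀ N, 0 < ℓ N) ∧
  (∀ (N : ℕ) (y : T3), ℓ N ≤ Torus.euclidDist y 0 → ψ N y = 0) ∧
  (∃ Cψ : ℝ, ∀ (N : ℕ) (y : T3), ψ N y ≤ Cψ * (ℓ N)⁻¹ ^ 3) ∧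
  (∃ cψ : ℝ, 0 < cψ ∧ ∀ (N : ℕ) (y : T3), Torus.euclidDist y 0 ≤ ℓ N / 2 → cψ * (ℓ N)⁻¹ ^ 3 ≤ ψ N y) ∧
  Tendsto (fun N : ℕ => ℓ N * ((N + 1 : ℕ) : ℝ) ^ ((1 : ℝ) / 6)) atTop (𝓝 0) ∧
  Tendsto (fun N : ℕ => ((N + 1 : ℕ) : ℝ) * ℓ N ^ 3) atTop atTop

/-- KINETIC WINDOWS: verbatim the window conditions of H1 (`DiffuseAt`): `Δ_N > 0`, `Δ_N → 0`,
`Δ_N (N+1)^{1/3} → ∞` (`K_N ≍ σ² Δ_N (N+1)^{1/3} → ∞` collisions per particle per window). -/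
def Window (Δ : ℕ → ℝ) : Prop :=
  (∀ N, 0 < Δ N) ∧ Tendsto Δ atTop (𝓝 0) ∧
    Tendsto (fun N : ℕ => Δ N * ((N + 1 : ℕ) : ℝ) ^ ((1 : ℝ) / 3)) atTop atTop

/-- The CELL VELOCITY of particle `i`: the `ψ`-cell mean velocity `ū_ψ` of the configuration read at the particle's own
position (junk `0` on an empty cell, as `ubarC`). This is the predictor subtracted from each particle velocity. -/
def cvel (N : ℕ) (ψ : ℕ → T3 → ℝ) (w : Cfg N) (i : Fin (N + 1)) : V3 :=
  ubarC N ψ w (w i).1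

/-- Rank-`r` block average at `x` (block kernel `φ`) of the PECULIAR tensors of the particles RELATIVE TO THEIR CELL
VELOCITIES: `(N+1)⁻¹ Σᵢ φ_N(xᵢ − x) ⟨C, (vᵢ − cvelᵢ)^{⊗r}⟩` (compare `blkC`, which subtracts the BLOCK velocity `ū(x)`). -/
def pecA (r N : ℕ) (φ ψ : ℕ → T3 → ℝ) (w : Cfg N) (x : T3) (C : Tens r) : ℝ :=
  ((N + 1 : ℕ) : ℝ)⁻¹ * ∑ i : Fin (N + 1), wgtC N φ w x i * pairT C (tpow r ((w i).2 - cvel N ψ w i))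

/-- The KINETIC CELL-ANISOTROPY DENSITY seen by the block at `x`: `Σ_{jk} pecA₂(C2 j k)² + Σ_a pecA₃(C3 a)²` — the block
defect `defectC` with the block velocity replaced by the cell velocities (so sub-block shear / sound between the cell and
the block scale does NOT enter it; it is moved into `reyC`). -/
def cellA (N : ℕ) (φ ψ : ℕ → T3 → ℝ) (w : Cfg N) (x : T3) : ℝ :=
  (∑ j : Fin 3, ∑ k : Fin 3, pecA 2 N φ ψ w x (C2 j k) ^ 2) + ∑ a : Fin 3, pecA 3 N φ ψ w x (C3 a) ^ 2

/-- ENERGY WEIGHT of the split at `x`: block average of `1 + |vᵢ − cvelᵢ|² + |vᵢ − cvelᵢ|⁴ + |cvelᵢ − ū(x)|²`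
(dominates each of the four block moments `E₂, E₄, R₂` and the block mass that multiply a Reynolds factor in the split). -/
def ethC (N : ℕ) (φ ψ : ℕ → T3 → ℝ) (w : Cfg N) (x : T3) : ℝ :=
  ((N + 1 : ℕ) : ℝ)⁻¹ * ∑ i : Fin (N + 1), wgtC N φ w x i *
    (1 + ‖(w i).2 - cvel N ψ w i‖ ^ 2 + ‖(w i).2 - cvel N ψ w i‖ ^ 4 + ‖cvel N ψ w i - ubarC N φ w x‖ ^ 2)

/-- SUB-BLOCK (REYNOLDS) FLUCTUATION of the cell velocities about the block velocity at `x`: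
block average of `|cvelᵢ − ū(x)|² + |cvelᵢ − ū(x)|⁴` (`R₂ + R₄`). Vanishes iff the cell-velocity field is block-wise
constant on the block's particles; thermal value `≍ θ/m_cell`. -/
def reyC (N : ℕ) (φ ψ : ℕ → T3 → ℝ) (w : Cfg N) (x : T3) : ℝ :=
  ((N + 1 : ℕ) : ℝ)⁻¹ * ∑ i : Fin (N + 1), wgtC N φ w x i *
    (‖cvel N ψ w i - ubarC N φ w x‖ ^ 2 + ‖cvel N ψ w i - ubarC N φ w x‖ ^ 4)

/-- The CELL PART of the crux functional on `[0, t]`: `∫₀ᵗ ∫ₓ cellA(Φ_s z, x)`. -/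
def CellInt (σ : ℝ) (N : ℕ) (Φ : Flow σ N) (φ ψ : ℕ → T3 → ℝ) (t : ℝ) (z : Cfg N) : ℝ :=
  ∫ s in Icc 0 t, ∫ x, cellA N φ ψ (Φ.flow s z) x

/-- The REYNOLDS PART of the crux functional on `[0, t]`: `∫₀ᵗ ∫ₓ ethC · reyC (Φ_s z, x)` (energy-weighted). -/
def ReynInt (σ : ℝ) (N : ℕ) (Φ : Flow σ N) (φ ψ : ℕ → T3 → ℝ) (t : ℝ) (z : Cfg N) : ℝ :=
  ∫ s in Icc 0 t, ∫ x, ethC N φ ψ (Φ.flow s z) x * reyC N φ ψ (Φ.flow s z) x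

/-- WINDOW-AVERAGED cell anisotropy with window end `t'`: `Δ⁻¹ ∫_{t'−Δ}^{t'} ∫ₓ cellA(Φ_s z, x)`. -/
def winA (σ : ℝ) (N : ℕ) (Φ : Flow σ N) (φ ψ : ℕ → T3 → ℝ) (Δ t' : ℝ) (z : Cfg N) : ℝ :=
  Δ⁻¹ * ∫ s in Icc (t' - Δ) t', ∫ x, cellA N φ ψ (Φ.flow s z) x

/-- WINDOW-LOCAL exponential velocity moment with window end `t'`: `Δ⁻¹ ∫_{t'−Δ}^{t'} ∫ e^{λ|v|²} dμ_{Φ_s z}` (H2's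
integrand verbatim, averaged over the window instead of integrated over `[0, t]`; TRIAGE-r1-2 (c), r1-3 (2)). -/
def winTail (σ : ℝ) (N : ℕ) (Φ : Flow σ N) (lam Δ t' : ℝ) (z : Cfg N) : ℝ :=
  Δ⁻¹ * ∫ s in Icc (t' - Δ) t', ∫ y, Real.exp (lam * ‖y.2‖ ^ 2) ∂(empiricalMeasure (Φ.flow s z))

/-- The SUSTAINED-ANISOTROPY EVENT with window `[t' − Δ, t']`: window-averaged cell anisotropy `≥ a` AND the crux's window
ipr (H1's functional on the same window, `iprF` at the window start) `≤ ε` AND window-local exponential moment `≤ Cw`. -/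
def susEvent (σ : ℝ) (N : ℕ) (Φ : Flow σ N) (φ ψ : ℕ → T3 → ℝ) (Δ a ε lam Cw t' : ℝ) : Set (Cfg N) :=
  {z | a ≤ winA σ N Φ φ ψ Δ t' z ∧ iprF σ N (Φ.flow (t' - Δ) z) Δ ≤ ε ∧ winTail σ N Φ lam Δ t' z ≤ Cw}

/-! ## The statements of the four stubs as named propositions (for the composition) -/

/-- Statement of STUB 1 (scale split). -/
def ScaleSplitStub : Prop := ∃ K : ℝ, 0 < K ∧ ∀ σ : ℝ, 0 < σ → σ < 2⁻¹ →
  ∀ (a₀ θ₀ : T3 → ℝ) (u₀ : T3 → V3) (Φ : Flows σ) (γ C : ℝ) (φ : ℕ → T3 → ℝ), 0 < γ → γ ≤ 1 / 15 →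
    AdmissibleKernel γ C φ → ∀ (ψ : ℕ → T3 → ℝ) (ℓ : ℕ → ℝ), CellKernel ψ ℓ → ∀ t : ℝ, 0 < t → ∀ δ : ℝ, 0 < δ →
      ∀ᶠ N : ℕ in atTop,
        localGibbsLaw σ a₀ u₀ θ₀ N (Φ N) {z | δ < ∫ s in Icc 0 t, ∫ x, DefectSq σ N (Φ N) φ s z x} ≤
          localGibbsLaw σ a₀ u₀ θ₀ N (Φ N) {z | K⁻¹ * δ < CellInt σ N (Φ N) φ ψ t z} +
            localGibbsLaw σ a₀ u₀ θ₀ N (Φ N) {z | K⁻¹ * δ < ReynInt σ N (Φ N) φ ψ t z}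

/-- Statement of STUB 2 (Reynolds remainder; declared exposure). -/
def ReynoldsStub : Prop := ∀ (a₀ θ₀ : T3 → ℝ) (u₀ : T3 → V3), NiceProfiles a₀ θ₀ u₀ →
  ∃ σ₀ : ℝ, 0 < σ₀ ∧ ∀ σ : ℝ, 0 < σ → σ < σ₀ → ∀ Φ : Flows σ, DiffuseAt σ a₀ θ₀ u₀ Φ →
    ∀ (γ C : ℝ) (φ : ℕ → T3 → ℝ), 0 < γ → γ ≤ 1 / 15 → AdmissibleKernel γ C φ →
      ∀ (ψ : ℕ → T3 → ℝ) (ℓ : ℕ → ℝ), CellKernel ψ ℓ → ∀ t : ℝ, 0 < t → TailsOn σ a₀ θ₀ u₀ Φ t →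
        ∀ κ : ℝ, 0 < κ →
          Tendsto (fun N : ℕ => localGibbsLaw σ a₀ u₀ θ₀ N (Φ N) {z | κ < ReynInt σ N (Φ N) φ ψ t z}) atTop (𝓝 0)

/-- Statement of STUB 3 (equilibrium super-exponential rarity of sustained cell anisotropy; hardest). -/
def SuperExpStub : Prop := ∀ θe : ℝ, 0 < θe → ∃ σ₁ : ℝ, 0 < σ₁ ∧ ∀ σ : ℝ, 0 < σ → σ < σ₁ →
  ∀ (γ C : ℝ) (φ : ℕ → T3 → ℝ), 0 < γ → γ ≤ 1 / 15 → AdmissibleKernel γ C φ →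
    ∃ (ψ : ℕ → T3 → ℝ) (ℓ Δ : ℕ → ℝ), CellKernel ψ ℓ ∧ Window Δ ∧
      Tendsto (fun N : ℕ => Δ N / (ℓ N ^ 2 * ((N + 1 : ℕ) : ℝ) ^ ((1 : ℝ) / 3))) atTop atTop ∧
      Tendsto (fun N : ℕ => Δ N * ((N + 1 : ℕ) : ℝ) ^ ((1 : ℝ) / 3) / (((N + 1 : ℕ) : ℝ) * ℓ N ^ 3)) atTop atTop ∧
      ∀ (Φ : Flows σ) (a lam Cw : ℝ), 0 < a → 0 < lam → 0 < Cw → ∃ ε : ℝ, 0 < ε ∧ ∀ c : ℝ, 0 < c →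
        ∀ᶠ N : ℕ in atTop, ∀ t' : ℝ, Δ N ≤ t' →
          localGibbsLaw σ (fun _ => 1) (fun _ => 0) (fun _ => θe) N (Φ N)
              (susEvent σ N (Φ N) φ ψ (Δ N) a ε lam Cw t') ≤
            ENNReal.ofReal (Real.exp (-(c * ((N : ℝ) + 1))))

/-- Statement of STUB 4 (from per-window smallness to the horizon; uses H1 and H2). -/
def WindowStub : Prop := ∀ (a₀ θ₀ : T3 → ℝ) (u₀ : T3 → V3), NiceProfiles a₀ θ₀ u₀ →
  ∀ σ : ℝ, 0 < σ → σ < 2⁻¹ → ∀ Φ : Flows σ, DiffuseAt σ a₀ θ₀ u₀ Φ →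
    ∀ (γ C : ℝ) (φ : ℕ → T3 → ℝ), 0 < γ → γ ≤ 1 / 15 → AdmissibleKernel γ C φ →
      ∀ (ψ : ℕ → T3 → ℝ) (ℓ : ℕ → ℝ), CellKernel ψ ℓ → ∀ Δ : ℕ → ℝ, Window Δ →
        ∀ t : ℝ, 0 < t → TailsOn σ a₀ θ₀ u₀ Φ t →
          (∀ (a lam Cw : ℝ), 0 < a → 0 < lam → 0 < Cw → ∃ ε : ℝ, 0 < ε ∧ ∀ η : ℝ, 0 < η →
              ∀ᶠ N : ℕ in atTop, ∀ t' : ℝ, Δ N ≤ t' →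
                localGibbsLaw σ a₀ u₀ θ₀ N (Φ N) (susEvent σ N (Φ N) φ ψ (Δ N) a ε lam Cw t') ≤ ENNReal.ofReal η) →
            ∀ κ : ℝ, 0 < κ →
              Tendsto (fun N : ℕ => localGibbsLaw σ a₀ u₀ θ₀ N (Φ N) {z | κ < CellInt σ N (Φ N) φ ψ t z}) atTop (𝓝 0)

/-! ## Anchor (registered stub `sa_vocabulary_anchor`: lets this definitions file ride `--supports`) -/

/-- Anchor of the vocabulary file: a kinetic window is positive at every `N` (first clause of `Window`). -/
theorem sa_vocabulary_anchor : ∀ Δ : ℕ → ℝ, Window Δ → ∀ N : ℕ, 0 < Δ N :=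
  fun _ h N => h.1 N

end

end Summit.AtomisticToContinuum.HydrodynamicLimit.Theorems.SustainedAnisotropy
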